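import Literature.Computability.MetaComplexity.MCSPHybridAverage
import Literature.Computability.MetaComplexity.MCSPDistinguisherTools
import Literature.Computability.Cryptography.StatisticalDistance
import HarnessLib

/-!
# The uniform `MCSP` distinguisher: its distinguishing gap (proofs)

Part of the proof architecture of the named fact `AllenderEtAl2006_MCSP_universalInverter`
(`MCSPUniversalInverter.lean`; Allender–Buhrman–Koucký–van Melkebeek–Ronneburger 2006, Thm. 45
with §4.2). In the printed proof of Thm. 45 (p. 24 of the author version) the statistical test
`L` yields, "as in [RR97]", "a probabilistic oracle machine `M` using `L` that distinguishes `G_y`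
from the uniform distribution". The machine: on input `⟨y, z⟩` (`z ∈ {0,1}^{2ℓ}` the challenge)
it reads from its coins a step number `i < 2ᵏ`, a root label and a table of fresh labels, computes
the truth table of the leaf-bit function of the distinguisher tree of depth `k` for the halves of
`s ↦ G ⟨y, s⟩` with the halves of `z` planted at node `i` (`MetaComplexity/GGM.lean`: `distFun`),
and accepts iff that truth table lies in `L`. This file ANALYSES that machine, abstractly in the
string function `h` computing the truth table (hypothesis `hh`, to be met by an `FP`
implementation) and in the one-query adversary `M` built from `h`
(`exists_oracleAdversary_of_mem_FP`, hypothesis `hM`):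

* `toReal_outputPMF_eq_card_div` — the acceptance probability of `M` on `⟨y, z⟩` is the fraction
  of pairs (step number, sample of fresh labels) whose distinguisher tree passes the test
  (prefix invariance of uniform coins, `map_uniform_vector_take`; the coin parsing is a bijection,
  `coinParse_bijective`);
* `uniformAvg_ideal_eq`, `uniformAvg_real_eq` — averaged over a uniform challenge, resp. over
  `z = G ⟨y, s⟩` with a uniform seed `s`, these are exactly the two averaged acceptance counts of
  `hybrid_average_advantage` (`halves_bijective`, `seed_bijective`, double counting);
* **`distinguisher_gap`** — hence, if the test rejects the truth table of every GGM leaf-bit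
  function of `G_y` at depth `k` and accepts at least a `B`-fraction of all truth tables of
  `k`-variable functions, then
  `Pr_{z ← U_{2ℓ}}[M^L(⟨y, z⟩) = 1] − Pr_{s ← U_ℓ}[M^L(⟨y, G ⟨y, s⟩⟩) = 1] ≥ B / 2ᵏ`.

Theorems only.

## References

* E. Allender et al., *Power from random strings*, SIAM J. Comput. 35(6) (2006)
  [AllenderEtAl2006]: proof of Thm. 45 (p. 24).
* A. A. Razborov, S. Rudich, *Natural proofs*, JCSS 55 (1997) [RazborovRudich1997]: proof of
  Thm. 4.1.
* S. Arora, B. Barak, *Computational Complexity: A Modern Approach*, CUP 2009 [AroraBarak2009]: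
  proof of Thm. 9.17 (p. 228), Def. 7.1 with §3.4.
-/

namespace Literature.Computability.MetaComplexity

open _root_.Computability Complexity Cryptography Finset

/-! ### Counting lemmas -/

/-- Double counting: `Σ_a #{b | P a b} = Σ_b #{a | P a b}`. [folklore] -/
private theorem sum_card_filter_comm {α β : Type*} [Fintype α] [Fintype β] (P : α → β → Prop)
    [∀ a b, Decidable (P a b)] :
    ∑ a, #{b : β | P a b} = ∑ b, #{a : α | P a b} := by
  simp only [Finset.card_filter]
  exact Finset.sum_comm

/-- Counting through a bijection: `#{a | P (e a)} = #{b | P b}`. [folklore] -/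
private theorem card_filter_comp_of_bijective {α β : Type*} [Fintype α] [Fintype β] {e : α → β}
    (he : Function.Bijective e) (P : β → Prop) [DecidablePred P] :
    #{a : α | P (e a)} = #{b : β | P b} := by
  simp only [Finset.card_filter]
  exact Fintype.sum_bijective e he _ _ fun _ => rfl

/-- Reading a prefix: `(ρ.take K)[t] = ρ[t]` for `t < K`. [folklore] -/
private theorem getD_take_of_lt (ρ : List Bool) {K t : ℕ} (ht : t < K) :
    (ρ.take K).getD t false = ρ.getD t false := by
  simp [List.getD_eq_getElem?_getD, List.getElem?_take_of_lt ht]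

/-! ### The acceptance probability of a one-query adversary reading a prefix of its coins -/

/-- **Acceptance probability as a counting probability over a coin prefix.** If the output law
of `M` on `w` is the law of `some (F r)` for uniform coins `r ∈ {0,1}^{c}` and `F` only reads the
first `K ≤ c` coins, `F ρ = Φ (ρ.take K)`, then `Pr[M(w) = 1] = #{v ∈ {0,1}ᴷ | Φ v} / 2ᴷ`.
[folklore] [cite: AroraBarak2009, Def. 7.1] -/
theorem toReal_map_some_eq_card_div {cw K : ℕ} (hK : K ≤ cw) (F Φ : List Bool → Bool)
    (hF : ∀ ρ : List Bool, ρ.length = cw → F ρ = Φ (ρ.take K)) :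
    (((PMF.uniformOfFintype (List.Vector Bool cw)).map fun r => some (F r.toList)) (some true)).toReal =
      (#{v : List.Vector Bool K | Φ v.toList = true} : ℝ) / 2 ^ K := by
  classical
  have e1 : (fun r : List.Vector Bool cw => some (F r.toList)) =
      fun r => (fun ρ => some (Φ ρ)) (r.toList.take K) :=
    funext fun r => by rw [hF r.toList (by simp)]
  rw [e1, map_uniform_vector_take hK (fun ρ => some (Φ ρ))]
  refine (toReal_map_uniform_vector_apply (fun ρ => some (Φ ρ)) (some true)).trans ?_
  congr 2
  congr 1
  ext v
  simp

/-! ### The distinguishing gap -/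

section Gap

variable {ℓ m : ℕ}

open scoped Classical in
/-- **The acceptance probability of the distinguisher on `⟨y, z⟩`** is the fraction of pairs
`(i, ω) ∈ Fin 2ᵏ × Sample ({0,1}^ℓ) k` (step number, fresh labels) for which the truth table of the
distinguisher tree with the halves of `z` planted at node `i` passes the test `A` — by prefix
invariance (`toReal_map_some_eq_card_div`) and the coin-parsing bijection (`coinParse_bijective`).
[cite: AllenderEtAl2006, Thm. 45 (proof, p. 24)] [cite: AroraBarak2009, proof of Thm. 9.17 p. 228] -/
theorem toReal_outputPMF_eq_card_div (g : Bool → (Fin ℓ → Bool) → (Fin ℓ → Bool))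
    (o : (Fin ℓ → Bool) → Bool) (y : List Bool) (A : Language Bool)
    (h : List Bool → List Bool)
    (hh : ∀ z ρ : List Bool, z.length = 2 * ℓ → (m + 1) + ℓ + 2 ^ (m + 2) * ℓ ≤ ρ.length →
      h (boolPair (boolPair y z) ρ) =
        truthTable (distFun g o
          ((fun j : Fin ℓ => ρ.getD ((m + 1) + j) false),
            fun (t : Fin (2 ^ (m + 1))) (b : Bool) (j : Fin ℓ) =>
              ρ.getD ((m + 1) + ℓ + (2 * t + cond b 1 0) * ℓ + j) false)
          (boolFunEquivFin (m + 1) fun t => ρ.getD t false)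
          (fun (b : Bool) (j : Fin ℓ) => z.getD (cond b (ℓ + j) j) false)))
    (M : OracleAdversary Bool) (c : Polynomial ℕ)
    (hM : ∀ w : List Bool, M.outputPMF (Oracle.ofLanguage A) w =
      (PMF.uniformOfFintype (List.Vector Bool (c.eval w.length))).map
        fun r => some ((h ⁻¹' A).boolIndicator (boolPair w r.toList)))
    (hc : ∀ z : List Bool, z.length = 2 * ℓ →
      (m + 1) + ℓ + 2 ^ (m + 2) * ℓ ≤ c.eval (boolPair y z).length)
    (z : List Bool) (hz : z.length = 2 * ℓ) :
    (M.outputPMF (Oracle.ofLanguage A) (boolPair y z) (some true)).toReal =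
      (#{q : Fin (2 ^ (m + 1)) × Sample (Fin ℓ → Bool) (m + 1) |
          truthTable (distFun g o q.2 q.1
            (fun (b : Bool) (j : Fin ℓ) => z.getD (cond b (ℓ + j) j) false)) ∈ A} : ℝ) /
        2 ^ ((m + 1) + ℓ + 2 ^ (m + 2) * ℓ) := by
  classical
  set K := (m + 1) + ℓ + 2 ^ (m + 2) * ℓ with hKdef
  set zh : Bool → Fin ℓ → Bool := fun b j => z.getD (cond b (ℓ + j) j) false with hzh
  -- the parsed data, as functions of the coin string
  set I : List Bool → Fin (2 ^ (m + 1)) := fun ρ =>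
    boolFunEquivFin (m + 1) fun t : Fin (m + 1) => ρ.getD t false with hI
  set X : List Bool → Fin ℓ → Bool := fun ρ j => ρ.getD ((m + 1) + j) false with hX
  set W : List Bool → Fin (2 ^ (m + 1)) → Bool → Fin ℓ → Bool := fun ρ t b j =>
    ρ.getD ((m + 1) + ℓ + (2 * t + cond b 1 0) * ℓ + j) false with hW
  have hh' : ∀ ρ : List Bool, K ≤ ρ.length →
      h (boolPair (boolPair y z) ρ) = truthTable (distFun g o (X ρ, W ρ) (I ρ) zh) :=
    fun ρ hρ => hh z ρ hz hρ
  -- they only depend on the first `K` coins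
  have hI' : ∀ ρ : List Bool, I (ρ.take K) = I ρ := fun ρ => by
    simp only [hI]
    congr 1
    funext t
    exact getD_take_of_lt ρ (by have := t.isLt; omega)
  have hX' : ∀ ρ : List Bool, X (ρ.take K) = X ρ := fun ρ => by
    simp only [hX]
    funext j
    exact getD_take_of_lt ρ (by have := j.isLt; omega)
  have hW' : ∀ ρ : List Bool, W (ρ.take K) = W ρ := fun ρ => by
    simp only [hW]
    funext t b j
    refine getD_take_of_lt ρ ?_
    have ht := t.isLt
    have hj := j.isLt
    have hb : cond b 1 0 ≤ 1 := by cases b <;> simp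
    have h2 : 2 * (t : ℕ) + cond b 1 0 + 1 ≤ 2 ^ (m + 2) := by
      have : 2 ^ (m + 2) = 2 * 2 ^ (m + 1) := by rw [pow_succ]; ring
      omega
    have h3 : (2 * (t : ℕ) + cond b 1 0) * ℓ + j < 2 ^ (m + 2) * ℓ := by
      calc (2 * (t : ℕ) + cond b 1 0) * ℓ + j < (2 * (t : ℕ) + cond b 1 0) * ℓ + ℓ := by omega
        _ = (2 * (t : ℕ) + cond b 1 0 + 1) * ℓ := by ring
        _ ≤ 2 ^ (m + 2) * ℓ := Nat.mul_le_mul_right _ h2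
    omega
  -- the test outcome as a function of the first `K` coins
  set Φ : List Bool → Bool := fun ρ =>
    decide (truthTable (distFun g o (X ρ, W ρ) (I ρ) zh) ∈ A) with hΦ
  have hΦ' : ∀ ρ : List Bool, Φ (ρ.take K) = Φ ρ := fun ρ => by
    simp only [hΦ]
    rw [hI', hX', hW']
  have hF : ∀ ρ : List Bool, ρ.length = c.eval (boolPair y z).length →
      (h ⁻¹' A).boolIndicator (boolPair (boolPair y z) ρ) = Φ (ρ.take K) := by
    intro ρ hρ
    have hKρ : K ≤ ρ.length := hρ ▸ hc z hz
    rw [hΦ', hΦ]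
    by_cases hmem : boolPair (boolPair y z) ρ ∈ h ⁻¹' A
    · rw [(Set.mem_iff_boolIndicator _ _).1 hmem]
      have : h (boolPair (boolPair y z) ρ) ∈ A := hmem
      rw [hh' ρ hKρ] at this
      exact (decide_eq_true this).symm
    · rw [(Set.notMem_iff_boolIndicator _ _).1 hmem]
      have : h (boolPair (boolPair y z) ρ) ∉ A := hmem
      rw [hh' ρ hKρ] at this
      exact (decide_eq_false this).symm
  rw [hM, toReal_map_some_eq_card_div (hc z hz) _ Φ hF]
  congr 1
  -- count through the coin-parsing bijection
  have hbij := coinParse_bijective (m + 1) ℓ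
  have e : #{v : List.Vector Bool K | Φ v.toList = true} =
      #{q : Fin (2 ^ (m + 1)) × Sample (Fin ℓ → Bool) (m + 1) |
        truthTable (distFun g o q.2 q.1 zh) ∈ A} := by
    rw [← card_filter_comp_of_bijective hbij]
    congr 1
    ext v
    simp [hΦ, hI, hX, hW]
  exact_mod_cast congrArg (fun n : ℕ => (n : ℝ)) e

open scoped Classical in
/-- **Ideal side.** Averaged over a uniform challenge `z ∈ {0,1}^{2ℓ}`, the acceptance
probability is `(Σᵢ Σ_ω #{z' : Bool → σ | tree(i, ω, z') passes}) / (2ᵏ · |samples| · |Bool → σ|)`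
(the halves reading is a bijection, `halves_bijective`; double counting).
[cite: AroraBarak2009, proof of Thm. 9.17 p. 228] -/
theorem uniformAvg_ideal_eq (g : Bool → (Fin ℓ → Bool) → (Fin ℓ → Bool))
    (o : (Fin ℓ → Bool) → Bool) (A : Language Bool) (acc : List Bool → ℝ)
    (hacc : ∀ z : List Bool, z.length = 2 * ℓ → acc z =
      (#{q : Fin (2 ^ (m + 1)) × Sample (Fin ℓ → Bool) (m + 1) |
          truthTable (distFun g o q.2 q.1
            (fun (b : Bool) (j : Fin ℓ) => z.getD (cond b (ℓ + j) j) false)) ∈ A} : ℝ) /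
        2 ^ ((m + 1) + ℓ + 2 ^ (m + 2) * ℓ)) :
    uniformAvg (2 * ℓ) acc =
      (∑ i : Fin (2 ^ (m + 1)), ∑ ω : Sample (Fin ℓ → Bool) (m + 1),
          (#{z' : Bool → Fin ℓ → Bool |
            decide (truthTable (distFun g o ω i z') ∈ A) = true} : ℝ)) /
        (2 ^ (m + 1) * Fintype.card (Sample (Fin ℓ → Bool) (m + 1)) *
          Fintype.card (Bool → Fin ℓ → Bool)) := by
  classical
  unfold uniformAvg
  rw [Finset.sum_congr rfl fun (v : List.Vector Bool (2 * ℓ)) _ => hacc v.toList (by simp)]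
  -- reindex the challenges by their halves
  rw [Function.Bijective.sum_comp (halves_bijective ℓ) (fun z' : Bool → Fin ℓ → Bool =>
      (#{q : Fin (2 ^ (m + 1)) × Sample (Fin ℓ → Bool) (m + 1) |
        truthTable (distFun g o q.2 q.1 z') ∈ A} : ℝ) / 2 ^ ((m + 1) + ℓ + 2 ^ (m + 2) * ℓ))]
  rw [← Finset.sum_div]
  -- double counting and the cardinalities
  have hdc : (∑ z' : Bool → Fin ℓ → Bool, (#{q : Fin (2 ^ (m + 1)) × Sample (Fin ℓ → Bool) (m + 1) |
      truthTable (distFun g o q.2 q.1 z') ∈ A} : ℝ)) =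
      ∑ i : Fin (2 ^ (m + 1)), ∑ ω : Sample (Fin ℓ → Bool) (m + 1),
        (#{z' : Bool → Fin ℓ → Bool | decide (truthTable (distFun g o ω i z') ∈ A) = true} : ℝ) := by
    have h1 := sum_card_filter_comm (fun (z' : Bool → Fin ℓ → Bool)
      (q : Fin (2 ^ (m + 1)) × Sample (Fin ℓ → Bool) (m + 1)) =>
        truthTable (distFun g o q.2 q.1 z') ∈ A)
    rw [Fintype.sum_prod_type] at h1
    have h2 : ∀ (i : Fin (2 ^ (m + 1))) (ω : Sample (Fin ℓ → Bool) (m + 1)),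
        #{z' : Bool → Fin ℓ → Bool | truthTable (distFun g o ω i z') ∈ A} =
          #{z' : Bool → Fin ℓ → Bool | decide (truthTable (distFun g o ω i z') ∈ A) = true} :=
      fun i ω => by congr 1; ext z'; simp
    simp only [h2] at h1
    exact_mod_cast h1
  rw [hdc]
  have hK : (2 : ℝ) ^ ((m + 1) + ℓ + 2 ^ (m + 2) * ℓ) * 2 ^ (2 * ℓ) =
      2 ^ (m + 1) * Fintype.card (Sample (Fin ℓ → Bool) (m + 1)) *
        Fintype.card (Bool → Fin ℓ → Bool) := by
    simp only [Fintype.card_prod, Fintype.card_fun, Fintype.card_bool, Fintype.card_fin]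
    push_cast
    simp only [← pow_mul, ← pow_add]
    congr 1
    ring
  rw [div_div, hK]

open scoped Classical in
/-- **Real side.** Averaged over `z = G ⟨y, s⟩` with a uniform seed `s ∈ {0,1}^ℓ` — for which the
halves of `z` are `(g 0 s, g 1 s)` — the acceptance probability is
`(Σᵢ Σ_ω #{s : σ | tree(i, ω, (g 0 s, g 1 s)) passes}) / (2ᵏ · |samples| · |σ|)`
(`seed_bijective`; double counting). [cite: AroraBarak2009, proof of Thm. 9.17 p. 228] -/
theorem uniformAvg_real_eq (G : List Bool → List Bool) (y : List Bool)
    (o : (Fin ℓ → Bool) → Bool) (A : Language Bool) (acc : List Bool → ℝ)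
    (hacc : ∀ s : List Bool, s.length = ℓ → acc s =
      (#{q : Fin (2 ^ (m + 1)) × Sample (Fin ℓ → Bool) (m + 1) |
          truthTable (distFun
            (fun (b : Bool) (s' : Fin ℓ → Bool) (j : Fin ℓ) =>
              (G (boolPair y (List.ofFn s'))).getD (cond b (ℓ + j) j) false) o q.2 q.1
            (fun (b : Bool) (j : Fin ℓ) =>
              (G (boolPair y s)).getD (cond b (ℓ + j) j) false)) ∈ A} : ℝ) /
        2 ^ ((m + 1) + ℓ + 2 ^ (m + 2) * ℓ)) :
    uniformAvg ℓ acc =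
      (∑ i : Fin (2 ^ (m + 1)), ∑ ω : Sample (Fin ℓ → Bool) (m + 1),
          (#{s' : Fin ℓ → Bool |
            decide (truthTable (distFun
              (fun (b : Bool) (s' : Fin ℓ → Bool) (j : Fin ℓ) =>
                (G (boolPair y (List.ofFn s'))).getD (cond b (ℓ + j) j) false) o ω i
              (fun b => (fun (b : Bool) (s' : Fin ℓ → Bool) (j : Fin ℓ) =>
                (G (boolPair y (List.ofFn s'))).getD (cond b (ℓ + j) j) false) b s')) ∈ A) =
              true} : ℝ)) /
        (2 ^ (m + 1) * Fintype.card (Sample (Fin ℓ → Bool) (m + 1)) *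
          Fintype.card (Fin ℓ → Bool)) := by
  classical
  set g : Bool → (Fin ℓ → Bool) → (Fin ℓ → Bool) := fun b s' j =>
    (G (boolPair y (List.ofFn s'))).getD (cond b (ℓ + j) j) false with hg
  unfold uniformAvg
  rw [Finset.sum_congr rfl fun (v : List.Vector Bool ℓ) _ => hacc v.toList (by simp)]
  -- the halves of `G ⟨y, s⟩` are `(g 0 s', g 1 s')` for the positional reading `s'` of `s`
  have hread : ∀ v : List.Vector Bool ℓ,
      (fun (b : Bool) (j : Fin ℓ) => (G (boolPair y v.toList)).getD (cond b (ℓ + j) j) false) =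
        fun b => g b (fun j : Fin ℓ => v.toList.getD j false) := by
    intro v
    funext b j
    simp only [hg, ofFn_getD_toList]
  simp only [hread]
  rw [Function.Bijective.sum_comp (seed_bijective ℓ) (fun s' : Fin ℓ → Bool =>
      (#{q : Fin (2 ^ (m + 1)) × Sample (Fin ℓ → Bool) (m + 1) |
        truthTable (distFun g o q.2 q.1 fun b => g b s') ∈ A} : ℝ) /
          2 ^ ((m + 1) + ℓ + 2 ^ (m + 2) * ℓ))]
  rw [← Finset.sum_div]
  have hdc : (∑ s' : Fin ℓ → Bool, (#{q : Fin (2 ^ (m + 1)) × Sample (Fin ℓ → Bool) (m + 1) |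
      truthTable (distFun g o q.2 q.1 fun b => g b s') ∈ A} : ℝ)) =
      ∑ i : Fin (2 ^ (m + 1)), ∑ ω : Sample (Fin ℓ → Bool) (m + 1),
        (#{s' : Fin ℓ → Bool |
          decide (truthTable (distFun g o ω i fun b => g b s') ∈ A) = true} : ℝ) := by
    have h1 := sum_card_filter_comm (fun (s' : Fin ℓ → Bool)
      (q : Fin (2 ^ (m + 1)) × Sample (Fin ℓ → Bool) (m + 1)) =>
        truthTable (distFun g o q.2 q.1 fun b => g b s') ∈ A)
    rw [Fintype.sum_prod_type] at h1
    have h2 : ∀ (i : Fin (2 ^ (m + 1))) (ω : Sample (Fin ℓ → Bool) (m + 1)),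
        #{s' : Fin ℓ → Bool | truthTable (distFun g o ω i fun b => g b s') ∈ A} =
          #{s' : Fin ℓ → Bool |
            decide (truthTable (distFun g o ω i fun b => g b s') ∈ A) = true} :=
      fun i ω => by congr 1; ext s'; simp
    simp only [h2] at h1
    exact_mod_cast h1
  rw [hdc]
  have hK : (2 : ℝ) ^ ((m + 1) + ℓ + 2 ^ (m + 2) * ℓ) * 2 ^ ℓ =
      2 ^ (m + 1) * Fintype.card (Sample (Fin ℓ → Bool) (m + 1)) * Fintype.card (Fin ℓ → Bool) := by
    simp only [Fintype.card_prod, Fintype.card_fun, Fintype.card_bool, Fintype.card_fin]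
    push_cast
    simp only [← pow_mul, ← pow_add]
    congr 1
    ring
  rw [div_div, hK]

open scoped Classical in
/-- **The distinguishing gap of the uniform `MCSP` distinguisher** (ABK⁺06, proof of Thm. 45:
"this gives us a probabilistic oracle machine `M` using `L` that distinguishes `G_y` from the
uniform distribution"; Razborov–Rudich 1997, proof of Thm. 4.1, in averaged form). Fix `ℓ ≥ 1`,
a depth `k = m + 1`, a parameter `y`, a map `G` doubling the length of `ℓ`-bit seeds under `y`, a
test language `A`, a string function `h` computing — from `⟨⟨y, z⟩, ρ⟩` — the truth table of the
leaf-bit (`bit 0`) function of the depth-`k` distinguisher tree for the halves of `s ↦ G ⟨y, s⟩`,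
with the step number, root label and fresh labels parsed from the coins `ρ` and the halves of `z`
as challenge (hypothesis `hh`), and a one-query adversary `M` accepting iff `h ⟨input, coins⟩ ∈ A`
with enough coins (hypotheses `hM`, `hc`). If `A` rejects the truth table of every GGM leaf-bit
function `u ↦ (ggmLab g x k u) 0` and accepts at least `B · 2^{2ᵏ}` truth tables of `k`-variable
functions, then `Pr_{z ← U_{2ℓ}}[M^A(⟨y, z⟩) = 1] − Pr_{s ← U_ℓ}[M^A(⟨y, G ⟨y, s⟩⟩) = 1] ≥ B/2ᵏ`.
[cite: AllenderEtAl2006, Thm. 45 (proof, p. 24)] [cite: RazborovRudich1997, Thm. 4.1 proof]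
[cite: AroraBarak2009, proof of Thm. 9.17 p. 228] -/
theorem distinguisher_gap (hℓ : 0 < ℓ) (G : List Bool → List Bool) (y : List Bool)
    (A : Language Bool) (h : List Bool → List Bool)
    (hh : ∀ z ρ : List Bool, z.length = 2 * ℓ → (m + 1) + ℓ + 2 ^ (m + 2) * ℓ ≤ ρ.length →
      h (boolPair (boolPair y z) ρ) =
        truthTable (distFun
          (fun (b : Bool) (s' : Fin ℓ → Bool) (j : Fin ℓ) =>
            (G (boolPair y (List.ofFn s'))).getD (cond b (ℓ + j) j) false)
          (fun s' : Fin ℓ → Bool => s' ⟨0, hℓ⟩)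
          ((fun j : Fin ℓ => ρ.getD ((m + 1) + j) false),
            fun (t : Fin (2 ^ (m + 1))) (b : Bool) (j : Fin ℓ) =>
              ρ.getD ((m + 1) + ℓ + (2 * t + cond b 1 0) * ℓ + j) false)
          (boolFunEquivFin (m + 1) fun t => ρ.getD t false)
          (fun (b : Bool) (j : Fin ℓ) => z.getD (cond b (ℓ + j) j) false)))
    (M : OracleAdversary Bool) (c : Polynomial ℕ)
    (hM : ∀ w : List Bool, M.outputPMF (Oracle.ofLanguage A) w =
      (PMF.uniformOfFintype (List.Vector Bool (c.eval w.length))).map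
        fun r => some ((h ⁻¹' A).boolIndicator (boolPair w r.toList)))
    (hc : ∀ z : List Bool, z.length = 2 * ℓ →
      (m + 1) + ℓ + 2 ^ (m + 2) * ℓ ≤ c.eval (boolPair y z).length)
    (hG2 : ∀ s : List Bool, s.length = ℓ → (G (boolPair y s)).length = 2 * ℓ)
    (hsmall : ∀ x : Fin ℓ → Bool,
      truthTable (fun u : Fin (m + 1) → Bool =>
        ggmLab (fun (b : Bool) (s' : Fin ℓ → Bool) (j : Fin ℓ) =>
          (G (boolPair y (List.ofFn s'))).getD (cond b (ℓ + j) j) false) x (m + 1) u ⟨0, hℓ⟩) ∉ A)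
    {B : ℝ} (hB : B * 2 ^ 2 ^ (m + 1) ≤
      #{f : (Fin (m + 1) → Bool) → Bool | truthTable f ∈ A}) :
    B / 2 ^ (m + 1) ≤
      uniformAvg (2 * ℓ) (fun z =>
        (M.outputPMF (Oracle.ofLanguage A) (boolPair y z) (some true)).toReal) -
      uniformAvg ℓ (fun s =>
        (M.outputPMF (Oracle.ofLanguage A) (boolPair y (G (boolPair y s))) (some true)).toReal) := by
  classical
  set g : Bool → (Fin ℓ → Bool) → (Fin ℓ → Bool) := fun b s' j =>
    (G (boolPair y (List.ofFn s'))).getD (cond b (ℓ + j) j) false with hg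
  set o : (Fin ℓ → Bool) → Bool := fun s' => s' ⟨0, hℓ⟩ with ho
  set T : ((Fin (m + 1) → Bool) → Bool) → Bool := fun f => decide (truthTable f ∈ A) with hT
  -- the acceptance probability on `⟨y, z⟩`
  have hacc := toReal_outputPMF_eq_card_div (m := m) g o y A h hh M c hM hc
  -- ideal and real averages
  have hideal := uniformAvg_ideal_eq (m := m) g o A
    (fun z => (M.outputPMF (Oracle.ofLanguage A) (boolPair y z) (some true)).toReal) hacc
  have hreal := uniformAvg_real_eq (m := m) G y o A
    (fun s => (M.outputPMF (Oracle.ofLanguage A) (boolPair y (G (boolPair y s))) (some true)).toReal)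
    (fun s hs => hacc (G (boolPair y s)) (hG2 s hs))
  rw [hideal, hreal]
  -- the averaged hybrid lemma
  have hA' : ∀ x : Fin ℓ → Bool, T (fun u => o (ggmLab g x (m + 1) u)) = false := fun x => by
    simp only [hT, ho, decide_eq_false_iff_not]
    exact hsmall x
  have hB' : B * 2 ^ 2 ^ (m + 1) ≤ #{f : (Fin (m + 1) → Bool) → Bool | T f = true} := by
    have : #{f : (Fin (m + 1) → Bool) → Bool | T f = true} =
        #{f : (Fin (m + 1) → Bool) → Bool | truthTable f ∈ A} := by
      congr 1; ext f; simp [hT]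
    rw [this]; exact hB
  have key := hybrid_average_advantage g o (flip := fun s => Function.update s ⟨0, hℓ⟩ (!s ⟨0, hℓ⟩))
    (fun s => by simp [ho]) (fun s => by
      ext j
      by_cases hj : j = ⟨0, hℓ⟩
      · subst hj; simp
      · simp [Function.update_of_ne hj]) T hA' hB'
  exact key

end Gap

end Literature.Computability.MetaComplexity
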